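import Literature.AlgebraicGeometry.PlaneCurves.HessePencilHessianGroup
import Literature.AlgebraicGeometry.PlaneCurves.WeierstrassNormalForm
import HarnessLib

/-!
# The Halphen cubics `B₁, …, B₈` under the Hessian group; all eight are projectively equivalent
# to the Fermat cubic (Artebani–Dolgachev §5, after Proposition 5.2, and Remark 5.3)

Topic `Literature/AlgebraicGeometry/PlaneCurves`, namespace
`Literature.AlgebraicGeometry.PlaneCurves`.
Lane `lit-hodgefound`, seat `lit-hodgefound-p37`, row g19-#7; a one-file sequel of the seat's
`HessePencilEightCubics` (g19-#3: the eight cubics `Bᵢ` of Prop. 5.2, their inflection triangles,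
`B₁ ∘ g₁ = ε²B₁`, `B₁ ∘ g₂ = B₁`, `B₂ ∘ g₁ = B₂`, `B₂ ∘ g₂ = εB₂`, `B₂ ∘ g₄ = εB₃`,
`B₂ ∘ g₄² = ε²B₄`, `Bᵢ ∘ g₀ = Bᵢ₊₄`) and `HessePencilHessianGroup` (g18-#5: the generators
`g₀, …, g₄`, `det g₃`).
It PROVES the three sentences the source prints after Prop. 5.2 — the permutation actions of
`g₃` and `g₄` on the eight cubics, the `Γ`-eigenvector property of all eight (Remark 5.3), and
"they are all projectively equivalent to `B₁`, which is obviously isomorphic to the Fermat cubic" —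
by explicit matrices and scalars.  Everything here is PROVED; no definition, no named fact.

Source followed — M. Artebani, I. Dolgachev, *The Hesse pencil of plane cubic curves*, Enseign.
Math. 55 (2009) 235–273, §5 [held `paper:arxiv-math_0611590` p0010 L45–L48, p0011 L15–L38],
VERBATIM (`ε = ω`, a primitive cube root of unity):

> `B₁ : x³ + εy³ + ε²z³ = 0`, `B₅ : x³ + ε²y³ + εz³ = 0`, `B₂ : x²y + y²z + z²x = 0`,
> `B₆ : x²z + y²x + z²y = 0`, `B₃ : x²y + ε²y²z + εz²x = 0`, `B₇ : x²z + εy²x + ε²z²y = 0`,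
> `B₄ : x²y + εy²z + ε²z²x = 0`, `B₈ : x²z + ε²y²x + εz²y = 0`. […] Now we apply the elements of
> the Hessian group to the curve `B₁` to get the remaining cubic curves `B₂, …, B₈`. Notice that
> the stabilizer of `B₁` in the Hessian group is generated by `Γ` and `g₄`. […] We will call the
> cubics `Bᵢ` the Halphen cubics. Observe that the element `g₀` from the Hessian group sends `Bᵢ`
> to `Bᵢ₊₄`. We will call the pairs `(Bᵢ, Bᵢ′ = Bᵢ₊₄)` the pairs of Halphen cubics […] It can be
> easily checked that the projective transformations `g₃, g₄` act on the Halphen cubics as follows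
> (with the obvious notation): `g₃ : (121′2′)(434′3′)`, `g₄ : (243)(2′4′3′)`.
> **Remark 5.3.** The linear representation of `Γ` on the space of homogeneous cubic polynomials
> decomposes into the sum of one-dimensional eigensubspaces. The cubic polynomials defining `Bᵢ`
> together with the polynomials `xyz, x³ + y³ + z³` form a basis of eigenvectors. Moreover, note
> that the cubics `Bᵢ` are equianharmonic cubics. In fact, they are all projectively equivalent to
> `B₁`, which is obviously isomorphic to the Fermat cubic.

(§4 of the source: `g₀(x, y, z) = (x, z, y)`, `g₁(x, y, z) = (y, z, x)`,
`g₂(x, y, z) = (x, εy, ε²z)`, `g₃ = [[1, 1, 1], [1, ε, ε²], [1, ε², ε]]`, `g₄ = diag(1, ε, ε)`,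
`Γ = ⟨g₁, g₂⟩`.)

## Dictionary

* `ω ∈ K` with `ω² + ω + 1 = 0` is `ε`; `ζ ∈ K` with `ζ³ = ω` (a primitive ninth root of unity
  when `3 ≠ 0`) is the cube root needed for "obviously isomorphic to the Fermat cubic".
* `𝐁₁[ω], …, 𝐁₈[ω]` are the eight printed forms (`𝐁₂`, `𝐁₆` do not involve `ε`); local notations,
  no definitions.  A projectivity `g` acts on forms by substitution,
  `B ∘ g := bind₁ g.toMvPolynomial B` (`B(g·v)`), so **`B_b ∘ g = c·B_a` (`c ≠ 0`) says that `g`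
  carries the CURVE `B_a` onto the curve `B_b`**; with this reading the identities below are
  literally the printed cycles `g₃ : 1 → 2 → 1′ → 2′ → 1`, `4 → 3 → 4′ → 3′ → 4` and
  `g₄ : 2 → 4 → 3 → 2`, `2′ → 4′ → 3′ → 2′`.
* "projectively equivalent": `∃ M, det M ≠ 0, ∃ c ≠ 0, B ∘ M = c·B′` (the lane's idiom, as in
  `HesseCanonicalForm`, `HessePencilTetrahedralOrbits`).

## What is proved (`K` any field; `ω² + ω + 1 = 0`; `ζ³ = ω` in §4–§5)

* §1 **`g₃ : (1 2 1′ 2′)(4 3 4′ 3′)`**: `halphen_B₂_bind₁_g₃` (`B₂ ∘ g₃ = 3B₁`),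
  `halphen_B₅_bind₁_g₃` (`B₅ ∘ g₃ = 9B₂`), `halphen_B₆_bind₁_g₃` (`B₆ ∘ g₃ = 3B₅`),
  `halphen_B₁_bind₁_g₃` (`B₁ ∘ g₃ = 9B₆`);
  `halphen_B₃_bind₁_g₃` (`B₃ ∘ g₃ = (3ω + 6)B₄`), `halphen_B₈_bind₁_g₃` (`B₈ ∘ g₃ = (3 − 3ω)B₃`),
  `halphen_B₇_bind₁_g₃` (`B₇ ∘ g₃ = (3ω + 6)B₈`), `halphen_B₄_bind₁_g₃` (`B₄ ∘ g₃ = (3 − 3ω)B₇`).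
* §2 **`g₄ : (2 4 3)(2′ 4′ 3′)`** and **"the stabilizer of `B₁` … is generated by `Γ` and `g₄`"**
  (the containment): `halphen_B₁_bind₁_g₄` (`B₁ ∘ g₄ = B₁`), `halphen_B₅_bind₁_g₄` (`B₅ ∘ g₄ = B₅`),
  `halphen_B₄_bind₁_g₄` (`B₄ ∘ g₄ = ωB₂`), `halphen_B₃_bind₁_g₄` (`B₃ ∘ g₄ = ωB₄`) [with the tree's
  `B₂ ∘ g₄ = ωB₃`: `2 → 4 → 3 → 2`], `halphen_B₈_bind₁_g₄` (`= ωB₆`), `halphen_B₆_bind₁_g₄`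
  (`= ωB₇`),
  `halphen_B₇_bind₁_g₄` (`= ωB₈`).
* §3 **Remark 5.3**: `halphen_Bᵢ_bind₁_g₁`, `halphen_Bᵢ_bind₁_g₂` for `i = 3, …, 8` — every `Bᵢ`
  is a common eigenvector of `g₁, g₂` (`B₁, B₂`: `HessePencilEightCubics.B_bind₁_Gamma`), with
  characters `(a, b)` (`Bᵢ ∘ g₁ = ω^a Bᵢ`, `Bᵢ ∘ g₂ = ω^b Bᵢ`) equal to
  `(2,0), (0,1), (1,1), (2,1), (1,0), (0,2), (2,2), (1,2)` for `i = 1, …, 8`: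
  `halphen_characters_nodup` — these are the EIGHT DISTINCT NON-TRIVIAL characters of
  `Γ ≅ (ℤ/3)²` (so the eight `Bᵢ` lie in eight different one-dimensional eigenspaces, and
  `xyz`, `x³ + y³ + z³` — the pencil — carry the trivial character).
* §4 **"`B₁` … is obviously isomorphic to the Fermat cubic"**: `halphen_B₁_bind₁_diag_zeta`
  (`B₁ ∘ diag(1, ζ², ζ) = x³ + y³ + z³`), `halphen_B₅_bind₁_diag_zeta`
  (`B₅ ∘ diag(1, ζ, ζ²) = x³ + y³ + z³`).
* §5 **"they are all projectively equivalent to `B₁`"**: explicit `Mᵢ ∈ ⟨g₀, g₃, g₄⟩` with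
  `Bᵢ ∘ Mᵢ = cᵢB₁`: `halphen_B₂_bind₁_equiv` (`M₂ = g₃`, `c = 3`), `halphen_B₃_bind₁_equiv`
  (`g₄²g₃`, `3ω²`), `halphen_B₄_bind₁_equiv` (`g₄g₃`, `3ω`), `halphen_B₅_bind₁_equiv` (`g₀`, `1`),
  `halphen_B₆_bind₁_equiv` (`g₀g₃`, `3`), `halphen_B₇_bind₁_equiv` (`g₀g₄²g₃`, `3ω²`),
  `halphen_B₈_bind₁_equiv` (`g₀g₄g₃`, `3ω`); their determinants `halphen_det_M₃, …, halphen_det_M₈`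
  (`±3ω^k(ω − 1)`, non-zero iff `3 ≠ 0`; `det g₃` is `HessePencilHessianGroup.det_g₃`); and the
  packaged statement **`halphen_exists_bind₁_eq_smul_fermat`**: for `3 ≠ 0`, `ω² + ω + 1 = 0`,
  `ζ³ = ω`, EACH of the eight Halphen cubics is projectively equivalent to the Fermat cubic
  `x³ + y³ + z³` (hence, by `HessePencilHarmonicMembers` / `HessePencilSpecialOrbits`,
  equianharmonic).

NOT here: that the stabilizer of `B₁` is EXACTLY `⟨Γ, g₄⟩` (a statement about all `216`
elements), the linear independence half of "form a basis" in Remark 5.3 (only the eigenvalue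
bookkeeping is given), the `9`-torsion assertion of Prop. 5.2 and the configuration i)–iii).

## References

* [ArtebaniDolgachev2009] M. Artebani, I. Dolgachev, *The Hesse pencil of plane cubic curves*,
  Enseign. Math. (2) 55 (2009) 235–273, §4 (the generators `gᵢ`), §5 (Prop. 5.2, the actions of
  `g₃, g₄`, Remark 5.3).
-/

set_option autoImplicit false

open MvPolynomial Matrix

namespace Literature.AlgebraicGeometry.PlaneCurves

universe u

/-- `B₁ = x³ + εy³ + ε²z³` (local notation, no definition). -/
local notation3 "𝐁₁[" ω "]" =>
  (X 0 ^ 3 + C ω * X 1 ^ 3 + C (ω ^ 2) * X 2 ^ 3 : MvPolynomial (Fin 3) _)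

/-- `B₅ = B₁′ = x³ + ε²y³ + εz³` (local notation, no definition). -/
local notation3 "𝐁₅[" ω "]" =>
  (X 0 ^ 3 + C (ω ^ 2) * X 1 ^ 3 + C ω * X 2 ^ 3 : MvPolynomial (Fin 3) _)

/-- `B₂ = x²y + y²z + z²x` (local notation, no definition). -/
local notation3 "𝐁₂" => (X 0 ^ 2 * X 1 + X 1 ^ 2 * X 2 + X 2 ^ 2 * X 0 : MvPolynomial (Fin 3) _)

/-- `B₆ = B₂′ = x²z + y²x + z²y` (local notation, no definition). -/
local notation3 "𝐁₆" => (X 0 ^ 2 * X 2 + X 1 ^ 2 * X 0 + X 2 ^ 2 * X 1 : MvPolynomial (Fin 3) _)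

/-- `B₃ = x²y + ε²y²z + εz²x` (local notation, no definition). -/
local notation3 "𝐁₃[" ω "]" =>
  (X 0 ^ 2 * X 1 + C (ω ^ 2) * (X 1 ^ 2 * X 2) + C ω * (X 2 ^ 2 * X 0) : MvPolynomial (Fin 3) _)

/-- `B₇ = B₃′ = x²z + εy²x + ε²z²y` (local notation, no definition). -/
local notation3 "𝐁₇[" ω "]" =>
  (X 0 ^ 2 * X 2 + C ω * (X 1 ^ 2 * X 0) + C (ω ^ 2) * (X 2 ^ 2 * X 1) : MvPolynomial (Fin 3) _)

/-- `B₄ = x²y + εy²z + ε²z²x` (local notation, no definition). -/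
local notation3 "𝐁₄[" ω "]" =>
  (X 0 ^ 2 * X 1 + C ω * (X 1 ^ 2 * X 2) + C (ω ^ 2) * (X 2 ^ 2 * X 0) : MvPolynomial (Fin 3) _)

/-- `B₈ = B₄′ = x²z + ε²y²x + εz²y` (local notation, no definition). -/
local notation3 "𝐁₈[" ω "]" =>
  (X 0 ^ 2 * X 2 + C (ω ^ 2) * (X 1 ^ 2 * X 0) + C ω * (X 2 ^ 2 * X 1) : MvPolynomial (Fin 3) _)

section HalphenCubics

variable {K : Type u} [Field K]

/-! ## §0 Plumbing -/

/-- The linear forms of a `3 × 3` substitution, written out. [folklore] -/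
private theorem toMvPolynomial_fin_three_h (M : Matrix (Fin 3) (Fin 3) K) (i : Fin 3) :
    M.toMvPolynomial i = C (M i 0) * X 0 + C (M i 1) * X 1 + C (M i 2) * X 2 := by
  simp only [Matrix.toMvPolynomial, Fin.sum_univ_three, ← C_mul_X_eq_monomial]

/-- `ω² + ω + 1 = 0 ⇒ (C ω)³ = 1`. [folklore] -/
private theorem C_omega_pow_three {ω : K} (hω : ω ^ 2 + ω + 1 = 0) :
    (C ω : MvPolynomial (Fin 3) K) ^ 3 = 1 := by
  have h : ω ^ 3 = 1 := by linear_combination (ω - 1) * hω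
  rw [← map_pow, h, map_one]

/-- `ω² + ω + 1 = 0` for `C ω`. [folklore] -/
private theorem C_omega_rel {ω : K} (hω : ω ^ 2 + ω + 1 = 0) :
    (C ω : MvPolynomial (Fin 3) K) ^ 2 + C ω + 1 = 0 := by
  have h := congrArg (C : K → MvPolynomial (Fin 3) K) hω
  simpa using h

/-- `ζ³ = ω` for `C ζ`. [folklore] -/
private theorem C_zeta_pow_three {ω ζ : K} (hζ : ζ ^ 3 = ω) :
    (C ζ : MvPolynomial (Fin 3) K) ^ 3 = C ω := by
  rw [← map_pow, hζ]


/-! ## §1 `g₃ : (1 2 1′ 2′)(4 3 4′ 3′)` on the Halphen cubics -/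

/-- `B₁ ∘ g₃ = 9·B₆` — `g₃` carries the curve `B₆` onto `B₁`. [cite: ArtebaniDolgachev2009, §5
(after Prop. 5.2: "`g₃ : (121′2′)(434′3′)`")] -/
theorem halphen_B₁_bind₁_g₃ {ω : K} (hω : ω ^ 2 + ω + 1 = 0) :
    bind₁ (Matrix.of ![![(1 : K), 1, 1], ![1, ω, ω ^ 2], ![1, ω ^ 2, ω]] :
        Matrix (Fin 3) (Fin 3) K).toMvPolynomial 𝐁₁[ω] =
      (9 : K) • (𝐁₆ : MvPolynomial (Fin 3) K) := by
  have hCrel := C_omega_rel hω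
  simp only [map_add, map_mul, map_pow, bind₁_X_right, bind₁_C_right, toMvPolynomial_fin_three_h,
    Matrix.of_apply, Matrix.cons_val_zero, Matrix.cons_val_one, Matrix.cons_val_two,
    Matrix.head_cons, Matrix.tail_cons, map_one, smul_eq_C_mul, map_ofNat]
  linear_combination (X 0 ^ 3 + 3 * X 0 ^ 2 * X 1 * C ω ^ 2 - 3 * X 0 ^ 2 * X 1 * C ω + 3 * X 0 ^ 2
    * X 1 + 6 * X 0 ^ 2 * X 2 * C ω - 6 * X 0 ^ 2 * X 2 + 3 * X 0 * X 1 ^ 2 * C ω ^ 4 - 3 * X 0 * X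
    1 ^ 2 * C ω ^ 3 + 6 * X 0 * X 1 ^ 2 * C ω - 6 * X 0 * X 1 ^ 2 + 6 * X 0 * X 1 * X 2 * C ω ^ 3 -
    6 * X 0 * X 1 * X 2 * C ω + 6 * X 0 * X 1 * X 2 + 3 * X 0 * X 2 ^ 2 * C ω ^ 3 - 3 * X 0 * X 2 ^
    2 * C ω + 3 * X 0 * X 2 ^ 2 + X 1 ^ 3 * C ω ^ 6 - (X 1 ^ 3 * C ω ^ 5) + X 1 ^ 3 * C ω ^ 3 - (X 1
    ^ 3 * C ω) + X 1 ^ 3 + 3 * X 1 ^ 2 * X 2 * C ω ^ 5 - 3 * X 1 ^ 2 * X 2 * C ω ^ 4 + 3 * X 1 ^ 2 *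
    X 2 * C ω ^ 3 - 3 * X 1 ^ 2 * X 2 * C ω + 3 * X 1 ^ 2 * X 2 + 6 * X 1 * X 2 ^ 2 * C ω ^ 4 - 6 *
    X 1 * X 2 ^ 2 * C ω ^ 3 + 6 * X 1 * X 2 ^ 2 * C ω - 6 * X 1 * X 2 ^ 2 + X 2 ^ 3 * C ω ^ 5 - (X 2
    ^ 3 * C ω ^ 4) + X 2 ^ 3 * C ω ^ 3 - (X 2 ^ 3 * C ω) + X 2 ^ 3 : MvPolynomial (Fin 3) K) * hCrel

/-- `B₂ ∘ g₃ = 3·B₁` — `g₃` carries the curve `B₁` onto `B₂`. [cite: ArtebaniDolgachev2009, §5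
(after Prop. 5.2: "`g₃ : (121′2′)(434′3′)`")] -/
theorem halphen_B₂_bind₁_g₃ {ω : K} (hω : ω ^ 2 + ω + 1 = 0) :
    bind₁ (Matrix.of ![![(1 : K), 1, 1], ![1, ω, ω ^ 2], ![1, ω ^ 2, ω]] :
        Matrix (Fin 3) (Fin 3) K).toMvPolynomial (𝐁₂ : MvPolynomial (Fin 3) K) =
      (3 : K) • 𝐁₁[ω] := by
  have hCrel := C_omega_rel hω
  simp only [map_add, map_mul, map_pow, bind₁_X_right, toMvPolynomial_fin_three_h, Matrix.of_apply,
    Matrix.cons_val_zero, Matrix.cons_val_one, Matrix.cons_val_two, Matrix.head_cons,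
    Matrix.tail_cons, map_one, smul_eq_C_mul, map_ofNat]
  linear_combination (3 * X 0 ^ 2 * X 1 + 3 * X 0 ^ 2 * X 2 + X 0 * X 1 ^ 2 * C ω ^ 2 + X 0 * X 1 ^
    2 * C ω + X 0 * X 1 ^ 2 + 2 * X 0 * X 1 * X 2 * C ω ^ 2 + 2 * X 0 * X 1 * X 2 * C ω + 2 * X 0 *
    X 1 * X 2 + X 0 * X 2 ^ 2 * C ω ^ 2 + X 0 * X 2 ^ 2 * C ω + X 0 * X 2 ^ 2 + 2 * X 1 ^ 3 * C ω ^
    2 - 2 * X 1 ^ 3 * C ω + 2 * X 1 ^ 2 * X 2 * C ω ^ 3 - (X 1 ^ 2 * X 2 * C ω ^ 2) + 2 * X 1 ^ 2 *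
    X 2 * C ω + X 1 * X 2 ^ 2 * C ω ^ 4 - (X 1 * X 2 ^ 2 * C ω ^ 3) + 2 * X 1 * X 2 ^ 2 * C ω ^ 2 +
    X 1 * X 2 ^ 2 * C ω + X 2 ^ 3 * C ω ^ 3 - (X 2 ^ 3 * C ω ^ 2) : MvPolynomial (Fin 3) K) * hCrel

/-- `B₃ ∘ g₃ = (3ω + 6)·B₄` — `g₃` carries the curve `B₄` onto `B₃`. [cite: ArtebaniDolgachev2009,
§5 (after Prop. 5.2: "`g₃ : (121′2′)(434′3′)`")] -/
theorem halphen_B₃_bind₁_g₃ {ω : K} (hω : ω ^ 2 + ω + 1 = 0) :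
    bind₁ (Matrix.of ![![(1 : K), 1, 1], ![1, ω, ω ^ 2], ![1, ω ^ 2, ω]] :
        Matrix (Fin 3) (Fin 3) K).toMvPolynomial 𝐁₃[ω] =
      (3 * ω + 6) • 𝐁₄[ω] := by
  have hCrel := C_omega_rel hω
  simp only [map_add, map_mul, map_pow, bind₁_X_right, bind₁_C_right, toMvPolynomial_fin_three_h,
    Matrix.of_apply, Matrix.cons_val_zero, Matrix.cons_val_one, Matrix.cons_val_two,
    Matrix.head_cons, Matrix.tail_cons, map_one, smul_eq_C_mul, map_ofNat]
  linear_combination (X 0 ^ 3 + X 0 ^ 2 * X 1 * C ω ^ 2 + 3 * X 0 ^ 2 * X 1 * C ω - 4 * X 0 ^ 2 * X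
    1 + 2 * X 0 ^ 2 * X 2 * C ω ^ 2 - (X 0 ^ 2 * X 2 * C ω) + 2 * X 0 ^ 2 * X 2 + 3 * X 0 * X 1 ^ 2
    * C ω ^ 3 - 2 * X 0 * X 1 ^ 2 * C ω ^ 2 + X 0 * X 1 ^ 2 * C ω + X 0 * X 1 ^ 2 + 2 * X 0 * X 1 *
    X 2 * C ω ^ 4 + 2 * X 0 * X 1 * X 2 * C ω ^ 2 + 2 * X 0 * X 1 * X 2 + X 0 * X 2 ^ 2 * C ω ^ 4 +
    X 0 * X 2 ^ 2 * C ω ^ 3 - 2 * X 0 * X 2 ^ 2 * C ω ^ 2 - (X 0 * X 2 ^ 2 * C ω) + X 0 * X 2 ^ 2 +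
    X 1 ^ 3 * C ω ^ 4 - (X 1 ^ 3 * C ω ^ 2) + X 1 ^ 3 * C ω + 2 * X 1 ^ 2 * X 2 * C ω ^ 5 - 2 * X 1
    ^ 2 * X 2 * C ω ^ 4 + 2 * X 1 ^ 2 * X 2 * C ω ^ 3 + 2 * X 1 ^ 2 * X 2 * C ω ^ 2 - 4 * X 1 ^ 2 *
    X 2 * C ω + X 1 * X 2 ^ 2 * C ω ^ 6 - (X 1 * X 2 ^ 2 * C ω ^ 5) + 2 * X 1 * X 2 ^ 2 * C ω ^ 4 -
    (X 1 * X 2 ^ 2 * C ω ^ 3) + X 1 * X 2 ^ 2 * C ω ^ 2 + X 1 * X 2 ^ 2 * C ω + X 2 ^ 3 * C ω ^ 5 -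
    (X 2 ^ 3 * C ω ^ 4) + X 2 ^ 3 * C ω ^ 2 : MvPolynomial (Fin 3) K) * hCrel

/-- `B₄ ∘ g₃ = (3 − 3ω)·B₇` — `g₃` carries the curve `B₇` onto `B₄`. [cite: ArtebaniDolgachev2009,
§5 (after Prop. 5.2: "`g₃ : (121′2′)(434′3′)`")] -/
theorem halphen_B₄_bind₁_g₃ {ω : K} (hω : ω ^ 2 + ω + 1 = 0) :
    bind₁ (Matrix.of ![![(1 : K), 1, 1], ![1, ω, ω ^ 2], ![1, ω ^ 2, ω]] :
        Matrix (Fin 3) (Fin 3) K).toMvPolynomial 𝐁₄[ω] =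
      (-3 * ω + 3) • 𝐁₇[ω] := by
  have hCrel := C_omega_rel hω
  simp only [map_add, map_mul, map_pow, bind₁_X_right, bind₁_C_right, toMvPolynomial_fin_three_h,
    Matrix.of_apply, Matrix.cons_val_zero, Matrix.cons_val_one, Matrix.cons_val_two,
    Matrix.head_cons, Matrix.tail_cons, map_one, smul_eq_C_mul, map_ofNat, map_neg]
  linear_combination (X 0 ^ 3 + 2 * X 0 ^ 2 * X 1 * C ω ^ 2 - (X 0 ^ 2 * X 1 * C ω) + 2 * X 0 ^ 2 *
    X 1 + 4 * X 0 ^ 2 * X 2 * C ω - (X 0 ^ 2 * X 2) + X 0 * X 1 ^ 2 * C ω ^ 4 - (X 0 * X 1 ^ 2 * C ω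
    ^ 3) + 4 * X 0 * X 1 ^ 2 * C ω ^ 2 - 2 * X 0 * X 1 ^ 2 * C ω + X 0 * X 1 ^ 2 + 4 * X 0 * X 1 * X
    2 * C ω ^ 3 + 2 * X 0 * X 1 * X 2 + X 0 * X 2 ^ 2 * C ω ^ 3 + 2 * X 0 * X 2 ^ 2 * C ω ^ 2 - (X 0
    * X 2 ^ 2 * C ω) + X 0 * X 2 ^ 2 + X 1 ^ 3 * C ω ^ 4 - (X 1 ^ 3 * C ω ^ 2) + X 1 ^ 3 * C ω + 3 *
    X 1 ^ 2 * X 2 * C ω ^ 4 - (X 1 ^ 2 * X 2 * C ω ^ 3) - (X 1 ^ 2 * X 2 * C ω ^ 2) + 2 * X 1 ^ 2 *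
    X 2 * C ω + X 1 * X 2 ^ 2 * C ω ^ 5 - (X 1 * X 2 ^ 2 * C ω ^ 4) + 4 * X 1 * X 2 ^ 2 * C ω ^ 3 -
    2 * X 1 * X 2 ^ 2 * C ω ^ 2 + X 1 * X 2 ^ 2 * C ω + X 2 ^ 3 * C ω ^ 4 - (X 2 ^ 3 * C ω ^ 3) + X
    2 ^ 3 * C ω ^ 2 : MvPolynomial (Fin 3) K) * hCrel

/-- `B₅ ∘ g₃ = 9·B₂` — `g₃` carries the curve `B₂` onto `B₅`. [cite: ArtebaniDolgachev2009, §5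
(after Prop. 5.2: "`g₃ : (121′2′)(434′3′)`")] -/
theorem halphen_B₅_bind₁_g₃ {ω : K} (hω : ω ^ 2 + ω + 1 = 0) :
    bind₁ (Matrix.of ![![(1 : K), 1, 1], ![1, ω, ω ^ 2], ![1, ω ^ 2, ω]] :
        Matrix (Fin 3) (Fin 3) K).toMvPolynomial 𝐁₅[ω] =
      (9 : K) • (𝐁₂ : MvPolynomial (Fin 3) K) := by
  have hCrel := C_omega_rel hω
  simp only [map_add, map_mul, map_pow, bind₁_X_right, bind₁_C_right, toMvPolynomial_fin_three_h,
    Matrix.of_apply, Matrix.cons_val_zero, Matrix.cons_val_one, Matrix.cons_val_two,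
    Matrix.head_cons, Matrix.tail_cons, map_one, smul_eq_C_mul, map_ofNat]
  linear_combination (X 0 ^ 3 + 6 * X 0 ^ 2 * X 1 * C ω - 6 * X 0 ^ 2 * X 1 + 3 * X 0 ^ 2 * X 2 * C
    ω ^ 2 - 3 * X 0 ^ 2 * X 2 * C ω + 3 * X 0 ^ 2 * X 2 + 3 * X 0 * X 1 ^ 2 * C ω ^ 3 - 3 * X 0 * X
    1 ^ 2 * C ω + 3 * X 0 * X 1 ^ 2 + 6 * X 0 * X 1 * X 2 * C ω ^ 3 - 6 * X 0 * X 1 * X 2 * C ω + 6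
    * X 0 * X 1 * X 2 + 3 * X 0 * X 2 ^ 2 * C ω ^ 4 - 3 * X 0 * X 2 ^ 2 * C ω ^ 3 + 6 * X 0 * X 2 ^
    2 * C ω - 6 * X 0 * X 2 ^ 2 + X 1 ^ 3 * C ω ^ 5 - (X 1 ^ 3 * C ω ^ 4) + X 1 ^ 3 * C ω ^ 3 - (X 1
    ^ 3 * C ω) + X 1 ^ 3 + 6 * X 1 ^ 2 * X 2 * C ω ^ 4 - 6 * X 1 ^ 2 * X 2 * C ω ^ 3 + 6 * X 1 ^ 2 *
    X 2 * C ω - 6 * X 1 ^ 2 * X 2 + 3 * X 1 * X 2 ^ 2 * C ω ^ 5 - 3 * X 1 * X 2 ^ 2 * C ω ^ 4 + 3 *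
    X 1 * X 2 ^ 2 * C ω ^ 3 - 3 * X 1 * X 2 ^ 2 * C ω + 3 * X 1 * X 2 ^ 2 + X 2 ^ 3 * C ω ^ 6 - (X 2
    ^ 3 * C ω ^ 5) + X 2 ^ 3 * C ω ^ 3 - (X 2 ^ 3 * C ω) + X 2 ^ 3 : MvPolynomial (Fin 3) K) * hCrel

/-- `B₆ ∘ g₃ = 3·B₅` — `g₃` carries the curve `B₅` onto `B₆`. [cite: ArtebaniDolgachev2009, §5
(after Prop. 5.2: "`g₃ : (121′2′)(434′3′)`")] -/
theorem halphen_B₆_bind₁_g₃ {ω : K} (hω : ω ^ 2 + ω + 1 = 0) :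
    bind₁ (Matrix.of ![![(1 : K), 1, 1], ![1, ω, ω ^ 2], ![1, ω ^ 2, ω]] :
        Matrix (Fin 3) (Fin 3) K).toMvPolynomial (𝐁₆ : MvPolynomial (Fin 3) K) =
      (3 : K) • 𝐁₅[ω] := by
  have hCrel := C_omega_rel hω
  simp only [map_add, map_mul, map_pow, bind₁_X_right, toMvPolynomial_fin_three_h, Matrix.of_apply,
    Matrix.cons_val_zero, Matrix.cons_val_one, Matrix.cons_val_two, Matrix.head_cons,
    Matrix.tail_cons, map_one, smul_eq_C_mul, map_ofNat]
  linear_combination (3 * X 0 ^ 2 * X 1 + 3 * X 0 ^ 2 * X 2 + X 0 * X 1 ^ 2 * C ω ^ 2 + X 0 * X 1 ^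
    2 * C ω + X 0 * X 1 ^ 2 + 2 * X 0 * X 1 * X 2 * C ω ^ 2 + 2 * X 0 * X 1 * X 2 * C ω + 2 * X 0 *
    X 1 * X 2 + X 0 * X 2 ^ 2 * C ω ^ 2 + X 0 * X 2 ^ 2 * C ω + X 0 * X 2 ^ 2 + X 1 ^ 3 * C ω ^ 3 -
    (X 1 ^ 3 * C ω ^ 2) + X 1 ^ 2 * X 2 * C ω ^ 4 - (X 1 ^ 2 * X 2 * C ω ^ 3) + 2 * X 1 ^ 2 * X 2 *
    C ω ^ 2 + X 1 ^ 2 * X 2 * C ω + 2 * X 1 * X 2 ^ 2 * C ω ^ 3 - (X 1 * X 2 ^ 2 * C ω ^ 2) + 2 * X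
    1 * X 2 ^ 2 * C ω + 2 * X 2 ^ 3 * C ω ^ 2 - 2 * X 2 ^ 3 * C ω : MvPolynomial (Fin 3) K) * hCrel

/-- `B₇ ∘ g₃ = (3ω + 6)·B₈` — `g₃` carries the curve `B₈` onto `B₇`. [cite: ArtebaniDolgachev2009,
§5 (after Prop. 5.2: "`g₃ : (121′2′)(434′3′)`")] -/
theorem halphen_B₇_bind₁_g₃ {ω : K} (hω : ω ^ 2 + ω + 1 = 0) :
    bind₁ (Matrix.of ![![(1 : K), 1, 1], ![1, ω, ω ^ 2], ![1, ω ^ 2, ω]] :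
        Matrix (Fin 3) (Fin 3) K).toMvPolynomial 𝐁₇[ω] =
      (3 * ω + 6) • 𝐁₈[ω] := by
  have hCrel := C_omega_rel hω
  simp only [map_add, map_mul, map_pow, bind₁_X_right, bind₁_C_right, toMvPolynomial_fin_three_h,
    Matrix.of_apply, Matrix.cons_val_zero, Matrix.cons_val_one, Matrix.cons_val_two,
    Matrix.head_cons, Matrix.tail_cons, map_one, smul_eq_C_mul, map_ofNat]
  linear_combination (X 0 ^ 3 + 2 * X 0 ^ 2 * X 1 * C ω ^ 2 - (X 0 ^ 2 * X 1 * C ω) + 2 * X 0 ^ 2 *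
    X 1 + X 0 ^ 2 * X 2 * C ω ^ 2 + 3 * X 0 ^ 2 * X 2 * C ω - 4 * X 0 ^ 2 * X 2 + X 0 * X 1 ^ 2 * C
    ω ^ 4 + X 0 * X 1 ^ 2 * C ω ^ 3 - 2 * X 0 * X 1 ^ 2 * C ω ^ 2 - (X 0 * X 1 ^ 2 * C ω) + X 0 * X
    1 ^ 2 + 2 * X 0 * X 1 * X 2 * C ω ^ 4 + 2 * X 0 * X 1 * X 2 * C ω ^ 2 + 2 * X 0 * X 1 * X 2 + 3
    * X 0 * X 2 ^ 2 * C ω ^ 3 - 2 * X 0 * X 2 ^ 2 * C ω ^ 2 + X 0 * X 2 ^ 2 * C ω + X 0 * X 2 ^ 2 +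
    X 1 ^ 3 * C ω ^ 5 - (X 1 ^ 3 * C ω ^ 4) + X 1 ^ 3 * C ω ^ 2 + X 1 ^ 2 * X 2 * C ω ^ 6 - (X 1 ^ 2
    * X 2 * C ω ^ 5) + 2 * X 1 ^ 2 * X 2 * C ω ^ 4 - (X 1 ^ 2 * X 2 * C ω ^ 3) + X 1 ^ 2 * X 2 * C ω
    ^ 2 + X 1 ^ 2 * X 2 * C ω + 2 * X 1 * X 2 ^ 2 * C ω ^ 5 - 2 * X 1 * X 2 ^ 2 * C ω ^ 4 + 2 * X 1
    * X 2 ^ 2 * C ω ^ 3 + 2 * X 1 * X 2 ^ 2 * C ω ^ 2 - 4 * X 1 * X 2 ^ 2 * C ω + X 2 ^ 3 * C ω ^ 4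
    - (X 2 ^ 3 * C ω ^ 2) + X 2 ^ 3 * C ω : MvPolynomial (Fin 3) K) * hCrel

/-- `B₈ ∘ g₃ = (3 − 3ω)·B₃` — `g₃` carries the curve `B₃` onto `B₈`. [cite: ArtebaniDolgachev2009,
§5 (after Prop. 5.2: "`g₃ : (121′2′)(434′3′)`")] -/
theorem halphen_B₈_bind₁_g₃ {ω : K} (hω : ω ^ 2 + ω + 1 = 0) :
    bind₁ (Matrix.of ![![(1 : K), 1, 1], ![1, ω, ω ^ 2], ![1, ω ^ 2, ω]] :
        Matrix (Fin 3) (Fin 3) K).toMvPolynomial 𝐁₈[ω] =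
      (-3 * ω + 3) • 𝐁₃[ω] := by
  have hCrel := C_omega_rel hω
  simp only [map_add, map_mul, map_pow, bind₁_X_right, bind₁_C_right, toMvPolynomial_fin_three_h,
    Matrix.of_apply, Matrix.cons_val_zero, Matrix.cons_val_one, Matrix.cons_val_two,
    Matrix.head_cons, Matrix.tail_cons, map_one, smul_eq_C_mul, map_ofNat, map_neg]
  linear_combination (X 0 ^ 3 + 4 * X 0 ^ 2 * X 1 * C ω - (X 0 ^ 2 * X 1) + 2 * X 0 ^ 2 * X 2 * C ω
    ^ 2 - (X 0 ^ 2 * X 2 * C ω) + 2 * X 0 ^ 2 * X 2 + X 0 * X 1 ^ 2 * C ω ^ 3 + 2 * X 0 * X 1 ^ 2 *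
    C ω ^ 2 - (X 0 * X 1 ^ 2 * C ω) + X 0 * X 1 ^ 2 + 4 * X 0 * X 1 * X 2 * C ω ^ 3 + 2 * X 0 * X 1
    * X 2 + X 0 * X 2 ^ 2 * C ω ^ 4 - (X 0 * X 2 ^ 2 * C ω ^ 3) + 4 * X 0 * X 2 ^ 2 * C ω ^ 2 - 2 *
    X 0 * X 2 ^ 2 * C ω + X 0 * X 2 ^ 2 + X 1 ^ 3 * C ω ^ 4 - (X 1 ^ 3 * C ω ^ 3) + X 1 ^ 3 * C ω ^
    2 + X 1 ^ 2 * X 2 * C ω ^ 5 - (X 1 ^ 2 * X 2 * C ω ^ 4) + 4 * X 1 ^ 2 * X 2 * C ω ^ 3 - 2 * X 1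
    ^ 2 * X 2 * C ω ^ 2 + X 1 ^ 2 * X 2 * C ω + 3 * X 1 * X 2 ^ 2 * C ω ^ 4 - (X 1 * X 2 ^ 2 * C ω ^
    3) - (X 1 * X 2 ^ 2 * C ω ^ 2) + 2 * X 1 * X 2 ^ 2 * C ω + X 2 ^ 3 * C ω ^ 4 - (X 2 ^ 3 * C ω ^
    2) + X 2 ^ 3 * C ω : MvPolynomial (Fin 3) K) * hCrel

/-! ## §2 `g₄ : (2 4 3)(2′ 4′ 3′)`; `g₄` fixes `B₁` and `B₁′ = B₅` -/

/-- `B₁ ∘ g₄ = B₁` (`g₄ = diag(1, ε, ε)`). [cite: ArtebaniDolgachev2009, §5 (after Prop. 5.2: "`g₄ :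
(243)(2′4′3′)`"; "the stabilizer of `B₁` in the Hessian group is generated by `Γ` and `g₄`")] -/
theorem halphen_B₁_bind₁_g₄ {ω : K} (hω : ω ^ 2 + ω + 1 = 0) :
    bind₁ (Matrix.of ![![(1 : K), 0, 0], ![0, ω, 0], ![0, 0, ω]] :
        Matrix (Fin 3) (Fin 3) K).toMvPolynomial 𝐁₁[ω] =
      𝐁₁[ω] := by
  have hC3 := C_omega_pow_three hω
  simp only [map_add, map_mul, map_pow, bind₁_X_right, bind₁_C_right, toMvPolynomial_fin_three_h,
    Matrix.of_apply, Matrix.cons_val_zero, Matrix.cons_val_one, Matrix.cons_val_two,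
    Matrix.head_cons, Matrix.tail_cons, map_one, map_zero]
  linear_combination (X 1 ^ 3 * C ω + X 2 ^ 3 * C ω ^ 2 : MvPolynomial (Fin 3) K) * hC3

/-- `B₃ ∘ g₄ = ω·B₄` (`g₄ = diag(1, ε, ε)`). [cite: ArtebaniDolgachev2009, §5 (after Prop. 5.2: "`g₄
: (243)(2′4′3′)`"; "the stabilizer of `B₁` in the Hessian group is generated by `Γ` and `g₄`")] -/
theorem halphen_B₃_bind₁_g₄ {ω : K} (hω : ω ^ 2 + ω + 1 = 0) :
    bind₁ (Matrix.of ![![(1 : K), 0, 0], ![0, ω, 0], ![0, 0, ω]] :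
        Matrix (Fin 3) (Fin 3) K).toMvPolynomial 𝐁₃[ω] =
      (ω) • 𝐁₄[ω] := by
  have hC3 := C_omega_pow_three hω
  simp only [map_add, map_mul, map_pow, bind₁_X_right, bind₁_C_right, toMvPolynomial_fin_three_h,
    Matrix.of_apply, Matrix.cons_val_zero, Matrix.cons_val_one, Matrix.cons_val_two,
    Matrix.head_cons, Matrix.tail_cons, map_one, map_zero, smul_eq_C_mul]
  linear_combination (X 1 ^ 2 * X 2 * C ω ^ 2 : MvPolynomial (Fin 3) K) * hC3

/-- `B₄ ∘ g₄ = ω·B₂` (`g₄ = diag(1, ε, ε)`). [cite: ArtebaniDolgachev2009, §5 (after Prop. 5.2: "`g₄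
: (243)(2′4′3′)`"; "the stabilizer of `B₁` in the Hessian group is generated by `Γ` and `g₄`")] -/
theorem halphen_B₄_bind₁_g₄ {ω : K} (hω : ω ^ 2 + ω + 1 = 0) :
    bind₁ (Matrix.of ![![(1 : K), 0, 0], ![0, ω, 0], ![0, 0, ω]] :
        Matrix (Fin 3) (Fin 3) K).toMvPolynomial 𝐁₄[ω] =
      (ω) • (𝐁₂ : MvPolynomial (Fin 3) K) := by
  have hC3 := C_omega_pow_three hω
  simp only [map_add, map_mul, map_pow, bind₁_X_right, bind₁_C_right, toMvPolynomial_fin_three_h,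
    Matrix.of_apply, Matrix.cons_val_zero, Matrix.cons_val_one, Matrix.cons_val_two,
    Matrix.head_cons, Matrix.tail_cons, map_one, map_zero, smul_eq_C_mul]
  linear_combination (X 0 * X 2 ^ 2 * C ω + X 1 ^ 2 * X 2 * C ω : MvPolynomial (Fin 3) K) * hC3

/-- `B₅ ∘ g₄ = B₅` (`g₄ = diag(1, ε, ε)`). [cite: ArtebaniDolgachev2009, §5 (after Prop. 5.2: "`g₄ :
(243)(2′4′3′)`"; "the stabilizer of `B₁` in the Hessian group is generated by `Γ` and `g₄`")] -/
theorem halphen_B₅_bind₁_g₄ {ω : K} (hω : ω ^ 2 + ω + 1 = 0) :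
    bind₁ (Matrix.of ![![(1 : K), 0, 0], ![0, ω, 0], ![0, 0, ω]] :
        Matrix (Fin 3) (Fin 3) K).toMvPolynomial 𝐁₅[ω] =
      𝐁₅[ω] := by
  have hC3 := C_omega_pow_three hω
  simp only [map_add, map_mul, map_pow, bind₁_X_right, bind₁_C_right, toMvPolynomial_fin_three_h,
    Matrix.of_apply, Matrix.cons_val_zero, Matrix.cons_val_one, Matrix.cons_val_two,
    Matrix.head_cons, Matrix.tail_cons, map_one, map_zero]
  linear_combination (X 1 ^ 3 * C ω ^ 2 + X 2 ^ 3 * C ω : MvPolynomial (Fin 3) K) * hC3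

/-- `B₆ ∘ g₄ = ω·B₇` (`g₄ = diag(1, ε, ε)`). [cite: ArtebaniDolgachev2009, §5 (after Prop. 5.2: "`g₄
: (243)(2′4′3′)`"; "the stabilizer of `B₁` in the Hessian group is generated by `Γ` and `g₄`")] -/
theorem halphen_B₆_bind₁_g₄ (ω : K) :
    bind₁ (Matrix.of ![![(1 : K), 0, 0], ![0, ω, 0], ![0, 0, ω]] :
        Matrix (Fin 3) (Fin 3) K).toMvPolynomial (𝐁₆ : MvPolynomial (Fin 3) K) =
      (ω) • 𝐁₇[ω] := by
  simp only [map_add, map_mul, map_pow, bind₁_X_right, toMvPolynomial_fin_three_h, Matrix.of_apply,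
    Matrix.cons_val_zero, Matrix.cons_val_one, Matrix.cons_val_two, Matrix.head_cons,
    Matrix.tail_cons, map_one, map_zero, smul_eq_C_mul]
  ring

/-- `B₇ ∘ g₄ = ω·B₈` (`g₄ = diag(1, ε, ε)`). [cite: ArtebaniDolgachev2009, §5 (after Prop. 5.2: "`g₄
: (243)(2′4′3′)`"; "the stabilizer of `B₁` in the Hessian group is generated by `Γ` and `g₄`")] -/
theorem halphen_B₇_bind₁_g₄ {ω : K} (hω : ω ^ 2 + ω + 1 = 0) :
    bind₁ (Matrix.of ![![(1 : K), 0, 0], ![0, ω, 0], ![0, 0, ω]] :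
        Matrix (Fin 3) (Fin 3) K).toMvPolynomial 𝐁₇[ω] =
      (ω) • 𝐁₈[ω] := by
  have hC3 := C_omega_pow_three hω
  simp only [map_add, map_mul, map_pow, bind₁_X_right, bind₁_C_right, toMvPolynomial_fin_three_h,
    Matrix.of_apply, Matrix.cons_val_zero, Matrix.cons_val_one, Matrix.cons_val_two,
    Matrix.head_cons, Matrix.tail_cons, map_one, map_zero, smul_eq_C_mul]
  linear_combination (X 1 * X 2 ^ 2 * C ω ^ 2 : MvPolynomial (Fin 3) K) * hC3

/-- `B₈ ∘ g₄ = ω·B₆` (`g₄ = diag(1, ε, ε)`). [cite: ArtebaniDolgachev2009, §5 (after Prop. 5.2: "`g₄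
: (243)(2′4′3′)`"; "the stabilizer of `B₁` in the Hessian group is generated by `Γ` and `g₄`")] -/
theorem halphen_B₈_bind₁_g₄ {ω : K} (hω : ω ^ 2 + ω + 1 = 0) :
    bind₁ (Matrix.of ![![(1 : K), 0, 0], ![0, ω, 0], ![0, 0, ω]] :
        Matrix (Fin 3) (Fin 3) K).toMvPolynomial 𝐁₈[ω] =
      (ω) • (𝐁₆ : MvPolynomial (Fin 3) K) := by
  have hC3 := C_omega_pow_three hω
  simp only [map_add, map_mul, map_pow, bind₁_X_right, bind₁_C_right, toMvPolynomial_fin_three_h,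
    Matrix.of_apply, Matrix.cons_val_zero, Matrix.cons_val_one, Matrix.cons_val_two,
    Matrix.head_cons, Matrix.tail_cons, map_one, map_zero, smul_eq_C_mul]
  linear_combination (X 0 * X 1 ^ 2 * C ω + X 1 * X 2 ^ 2 * C ω : MvPolynomial (Fin 3) K) * hC3

/-! ## §3 Remark 5.3: the Halphen cubics are `Γ`-eigenvectors -/

/-- `B₃ ∘ g₁ = ω·B₃` — `B₃` is a `Γ`-eigenvector. [cite: ArtebaniDolgachev2009, §5, Remark 5.3] -/
theorem halphen_B₃_bind₁_g₁ {ω : K} (hω : ω ^ 2 + ω + 1 = 0) :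
    bind₁ (Matrix.of ![![(0 : K), 1, 0], ![0, 0, 1], ![1, 0, 0]] :
        Matrix (Fin 3) (Fin 3) K).toMvPolynomial 𝐁₃[ω] =
      (ω) • 𝐁₃[ω] := by
  have hC3 := C_omega_pow_three hω
  simp only [map_add, map_mul, map_pow, bind₁_X_right, bind₁_C_right, toMvPolynomial_fin_three_h,
    Matrix.of_apply, Matrix.cons_val_zero, Matrix.cons_val_one, Matrix.cons_val_two,
    Matrix.head_cons, Matrix.tail_cons, map_one, map_zero, smul_eq_C_mul]
  linear_combination (-(X 1 ^ 2 * X 2) : MvPolynomial (Fin 3) K) * hC3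

/-- `B₃ ∘ g₂ = ω·B₃` — `B₃` is a `Γ`-eigenvector. [cite: ArtebaniDolgachev2009, §5, Remark 5.3] -/
theorem halphen_B₃_bind₁_g₂ {ω : K} (hω : ω ^ 2 + ω + 1 = 0) :
    bind₁ (Matrix.of ![![(1 : K), 0, 0], ![0, ω, 0], ![0, 0, ω ^ 2]] :
        Matrix (Fin 3) (Fin 3) K).toMvPolynomial 𝐁₃[ω] =
      (ω) • 𝐁₃[ω] := by
  have hC3 := C_omega_pow_three hω
  simp only [map_add, map_mul, map_pow, bind₁_X_right, bind₁_C_right, toMvPolynomial_fin_three_h,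
    Matrix.of_apply, Matrix.cons_val_zero, Matrix.cons_val_one, Matrix.cons_val_two,
    Matrix.head_cons, Matrix.tail_cons, map_one, map_zero, smul_eq_C_mul]
  linear_combination (X 0 * X 2 ^ 2 * C ω ^ 2 + X 1 ^ 2 * X 2 * C ω ^ 3 : MvPolynomial (Fin 3) K) *
    hC3

/-- `B₄ ∘ g₁ = ω²·B₄` — `B₄` is a `Γ`-eigenvector. [cite: ArtebaniDolgachev2009, §5, Remark 5.3]
-/
theorem halphen_B₄_bind₁_g₁ {ω : K} (hω : ω ^ 2 + ω + 1 = 0) :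
    bind₁ (Matrix.of ![![(0 : K), 1, 0], ![0, 0, 1], ![1, 0, 0]] :
        Matrix (Fin 3) (Fin 3) K).toMvPolynomial 𝐁₄[ω] =
      (ω ^ 2) • 𝐁₄[ω] := by
  have hC3 := C_omega_pow_three hω
  simp only [map_add, map_mul, map_pow, bind₁_X_right, bind₁_C_right, toMvPolynomial_fin_three_h,
    Matrix.of_apply, Matrix.cons_val_zero, Matrix.cons_val_one, Matrix.cons_val_two,
    Matrix.head_cons, Matrix.tail_cons, map_one, map_zero, smul_eq_C_mul]
  linear_combination (-(X 0 * X 2 ^ 2 * C ω) - (X 1 ^ 2 * X 2) : MvPolynomial (Fin 3) K) * hC3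

/-- `B₄ ∘ g₂ = ω·B₄` — `B₄` is a `Γ`-eigenvector. [cite: ArtebaniDolgachev2009, §5, Remark 5.3] -/
theorem halphen_B₄_bind₁_g₂ {ω : K} (hω : ω ^ 2 + ω + 1 = 0) :
    bind₁ (Matrix.of ![![(1 : K), 0, 0], ![0, ω, 0], ![0, 0, ω ^ 2]] :
        Matrix (Fin 3) (Fin 3) K).toMvPolynomial 𝐁₄[ω] =
      (ω) • 𝐁₄[ω] := by
  have hC3 := C_omega_pow_three hω
  simp only [map_add, map_mul, map_pow, bind₁_X_right, bind₁_C_right, toMvPolynomial_fin_three_h,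
    Matrix.of_apply, Matrix.cons_val_zero, Matrix.cons_val_one, Matrix.cons_val_two,
    Matrix.head_cons, Matrix.tail_cons, map_one, map_zero, smul_eq_C_mul]
  linear_combination (X 0 * X 2 ^ 2 * C ω ^ 3 + X 1 ^ 2 * X 2 * C ω ^ 2 : MvPolynomial (Fin 3) K) *
    hC3

/-- `B₅ ∘ g₁ = ω·B₅` — `B₅` is a `Γ`-eigenvector. [cite: ArtebaniDolgachev2009, §5, Remark 5.3] -/
theorem halphen_B₅_bind₁_g₁ {ω : K} (hω : ω ^ 2 + ω + 1 = 0) :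
    bind₁ (Matrix.of ![![(0 : K), 1, 0], ![0, 0, 1], ![1, 0, 0]] :
        Matrix (Fin 3) (Fin 3) K).toMvPolynomial 𝐁₅[ω] =
      (ω) • 𝐁₅[ω] := by
  have hC3 := C_omega_pow_three hω
  simp only [map_add, map_mul, map_pow, bind₁_X_right, bind₁_C_right, toMvPolynomial_fin_three_h,
    Matrix.of_apply, Matrix.cons_val_zero, Matrix.cons_val_one, Matrix.cons_val_two,
    Matrix.head_cons, Matrix.tail_cons, map_one, map_zero, smul_eq_C_mul]
  linear_combination (-(X 1 ^ 3) : MvPolynomial (Fin 3) K) * hC3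

/-- `B₅ ∘ g₂ = B₅` — `B₅` is a `Γ`-eigenvector. [cite: ArtebaniDolgachev2009, §5, Remark 5.3] -/
theorem halphen_B₅_bind₁_g₂ {ω : K} (hω : ω ^ 2 + ω + 1 = 0) :
    bind₁ (Matrix.of ![![(1 : K), 0, 0], ![0, ω, 0], ![0, 0, ω ^ 2]] :
        Matrix (Fin 3) (Fin 3) K).toMvPolynomial 𝐁₅[ω] =
      𝐁₅[ω] := by
  have hC3 := C_omega_pow_three hω
  simp only [map_add, map_mul, map_pow, bind₁_X_right, bind₁_C_right, toMvPolynomial_fin_three_h,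
    Matrix.of_apply, Matrix.cons_val_zero, Matrix.cons_val_one, Matrix.cons_val_two,
    Matrix.head_cons, Matrix.tail_cons, map_one, map_zero]
  linear_combination (X 1 ^ 3 * C ω ^ 2 + X 2 ^ 3 * C ω ^ 4 + X 2 ^ 3 * C ω : MvPolynomial (Fin 3)
    K) * hC3

/-- `B₆ ∘ g₁ = B₆` — `B₆` is a `Γ`-eigenvector. [cite: ArtebaniDolgachev2009, §5, Remark 5.3] -/
theorem halphen_B₆_bind₁_g₁ :
    bind₁ (Matrix.of ![![(0 : K), 1, 0], ![0, 0, 1], ![1, 0, 0]] :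
        Matrix (Fin 3) (Fin 3) K).toMvPolynomial (𝐁₆ : MvPolynomial (Fin 3) K) =
      (𝐁₆ : MvPolynomial (Fin 3) K) := by
  simp only [map_add, map_mul, map_pow, bind₁_X_right, toMvPolynomial_fin_three_h, Matrix.of_apply,
    Matrix.cons_val_zero, Matrix.cons_val_one, Matrix.cons_val_two, Matrix.head_cons,
    Matrix.tail_cons, map_one, map_zero]
  ring

/-- `B₆ ∘ g₂ = ω²·B₆` — `B₆` is a `Γ`-eigenvector. [cite: ArtebaniDolgachev2009, §5, Remark 5.3]
-/
theorem halphen_B₆_bind₁_g₂ {ω : K} (hω : ω ^ 2 + ω + 1 = 0) :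
    bind₁ (Matrix.of ![![(1 : K), 0, 0], ![0, ω, 0], ![0, 0, ω ^ 2]] :
        Matrix (Fin 3) (Fin 3) K).toMvPolynomial (𝐁₆ : MvPolynomial (Fin 3) K) =
      (ω ^ 2) • (𝐁₆ : MvPolynomial (Fin 3) K) := by
  have hC3 := C_omega_pow_three hω
  simp only [map_add, map_mul, map_pow, bind₁_X_right, toMvPolynomial_fin_three_h, Matrix.of_apply,
    Matrix.cons_val_zero, Matrix.cons_val_one, Matrix.cons_val_two, Matrix.head_cons,
    Matrix.tail_cons, map_one, map_zero, smul_eq_C_mul]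
  linear_combination (X 1 * X 2 ^ 2 * C ω ^ 2 : MvPolynomial (Fin 3) K) * hC3

/-- `B₇ ∘ g₁ = ω²·B₇` — `B₇` is a `Γ`-eigenvector. [cite: ArtebaniDolgachev2009, §5, Remark 5.3]
-/
theorem halphen_B₇_bind₁_g₁ {ω : K} (hω : ω ^ 2 + ω + 1 = 0) :
    bind₁ (Matrix.of ![![(0 : K), 1, 0], ![0, 0, 1], ![1, 0, 0]] :
        Matrix (Fin 3) (Fin 3) K).toMvPolynomial 𝐁₇[ω] =
      (ω ^ 2) • 𝐁₇[ω] := by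
  have hC3 := C_omega_pow_three hω
  simp only [map_add, map_mul, map_pow, bind₁_X_right, bind₁_C_right, toMvPolynomial_fin_three_h,
    Matrix.of_apply, Matrix.cons_val_zero, Matrix.cons_val_one, Matrix.cons_val_two,
    Matrix.head_cons, Matrix.tail_cons, map_one, map_zero, smul_eq_C_mul]
  linear_combination (-(X 0 * X 1 ^ 2) - (X 1 * X 2 ^ 2 * C ω) : MvPolynomial (Fin 3) K) * hC3

/-- `B₇ ∘ g₂ = ω²·B₇` — `B₇` is a `Γ`-eigenvector. [cite: ArtebaniDolgachev2009, §5, Remark 5.3]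
-/
theorem halphen_B₇_bind₁_g₂ {ω : K} (hω : ω ^ 2 + ω + 1 = 0) :
    bind₁ (Matrix.of ![![(1 : K), 0, 0], ![0, ω, 0], ![0, 0, ω ^ 2]] :
        Matrix (Fin 3) (Fin 3) K).toMvPolynomial 𝐁₇[ω] =
      (ω ^ 2) • 𝐁₇[ω] := by
  have hC3 := C_omega_pow_three hω
  simp only [map_add, map_mul, map_pow, bind₁_X_right, bind₁_C_right, toMvPolynomial_fin_three_h,
    Matrix.of_apply, Matrix.cons_val_zero, Matrix.cons_val_one, Matrix.cons_val_two,
    Matrix.head_cons, Matrix.tail_cons, map_one, map_zero, smul_eq_C_mul]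
  linear_combination (X 1 * X 2 ^ 2 * C ω ^ 4 : MvPolynomial (Fin 3) K) * hC3

/-- `B₈ ∘ g₁ = ω·B₈` — `B₈` is a `Γ`-eigenvector. [cite: ArtebaniDolgachev2009, §5, Remark 5.3] -/
theorem halphen_B₈_bind₁_g₁ {ω : K} (hω : ω ^ 2 + ω + 1 = 0) :
    bind₁ (Matrix.of ![![(0 : K), 1, 0], ![0, 0, 1], ![1, 0, 0]] :
        Matrix (Fin 3) (Fin 3) K).toMvPolynomial 𝐁₈[ω] =
      (ω) • 𝐁₈[ω] := by
  have hC3 := C_omega_pow_three hω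
  simp only [map_add, map_mul, map_pow, bind₁_X_right, bind₁_C_right, toMvPolynomial_fin_three_h,
    Matrix.of_apply, Matrix.cons_val_zero, Matrix.cons_val_one, Matrix.cons_val_two,
    Matrix.head_cons, Matrix.tail_cons, map_one, map_zero, smul_eq_C_mul]
  linear_combination (-(X 0 * X 1 ^ 2) : MvPolynomial (Fin 3) K) * hC3

/-- `B₈ ∘ g₂ = ω²·B₈` — `B₈` is a `Γ`-eigenvector. [cite: ArtebaniDolgachev2009, §5, Remark 5.3]
-/
theorem halphen_B₈_bind₁_g₂ {ω : K} (hω : ω ^ 2 + ω + 1 = 0) :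
    bind₁ (Matrix.of ![![(1 : K), 0, 0], ![0, ω, 0], ![0, 0, ω ^ 2]] :
        Matrix (Fin 3) (Fin 3) K).toMvPolynomial 𝐁₈[ω] =
      (ω ^ 2) • 𝐁₈[ω] := by
  have hC3 := C_omega_pow_three hω
  simp only [map_add, map_mul, map_pow, bind₁_X_right, bind₁_C_right, toMvPolynomial_fin_three_h,
    Matrix.of_apply, Matrix.cons_val_zero, Matrix.cons_val_one, Matrix.cons_val_two,
    Matrix.head_cons, Matrix.tail_cons, map_one, map_zero, smul_eq_C_mul]
  linear_combination (X 1 * X 2 ^ 2 * C ω ^ 3 : MvPolynomial (Fin 3) K) * hC3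

/-- **Remark 5.3, the bookkeeping**: writing `Bᵢ ∘ g₁ = ω^{aᵢ}Bᵢ`, `Bᵢ ∘ g₂ = ω^{bᵢ}Bᵢ` (§3 and
`HessePencilEightCubics.B_bind₁_Gamma`), the characters `(aᵢ, bᵢ) ∈ (ℤ/3)²` of `B₁, …, B₈` are
`(2,0), (0,1), (1,1), (2,1), (1,0), (0,2), (2,2), (1,2)`: pairwise distinct and all different from
the trivial character `(0, 0)` of `xyz` and `x³ + y³ + z³` — the eight non-trivial characters of
`Γ ≅ (ℤ/3)²`, each occurring once ("decomposes into the sum of one-dimensional eigensubspaces").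
[cite: ArtebaniDolgachev2009, §5, Remark 5.3] -/
theorem halphen_characters_nodup :
    ([(2, 0), (0, 1), (1, 1), (2, 1), (1, 0), (0, 2), (2, 2), (1, 2)] :
        List (Fin 3 × Fin 3)).Nodup ∧
      ((0, 0) : Fin 3 × Fin 3) ∉
        ([(2, 0), (0, 1), (1, 1), (2, 1), (1, 0), (0, 2), (2, 2), (1, 2)] :
          List (Fin 3 × Fin 3)) := by
  decide


/-! ## §4 "`B₁` is obviously isomorphic to the Fermat cubic" -/

/-- **"`B₁` is obviously isomorphic to the Fermat cubic"**: with `ζ³ = ε` (a primitive ninth root of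
unity when `3 ≠ 0`), `B₁ ∘ diag(1, ζ², ζ) = X³ + Y³ + Z³`. [cite: ArtebaniDolgachev2009, §5, Remark
5.3] -/
theorem halphen_B₁_bind₁_diag_zeta {ω : K} (hω : ω ^ 2 + ω + 1 = 0) {ζ : K} (hζ : ζ ^ 3 = ω) :
    bind₁ (Matrix.of ![![(1 : K), 0, 0], ![0, ζ ^ 2, 0], ![0, 0, ζ]] :
        Matrix (Fin 3) (Fin 3) K).toMvPolynomial 𝐁₁[ω] =
      (X 0 ^ 3 + X 1 ^ 3 + X 2 ^ 3 : MvPolynomial (Fin 3) K) := by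
  have hC3 := C_omega_pow_three hω
  have hCζ := C_zeta_pow_three hζ
  simp only [map_add, map_mul, map_pow, bind₁_X_right, bind₁_C_right, toMvPolynomial_fin_three_h,
    Matrix.of_apply, Matrix.cons_val_zero, Matrix.cons_val_one, Matrix.cons_val_two,
    Matrix.head_cons, Matrix.tail_cons, map_one, map_zero]
  linear_combination (X 1 ^ 3 * C ω ^ 2 + X 1 ^ 3 * C ω * C ζ ^ 3 + X 2 ^ 3 * C ω ^ 2 : MvPolynomial
    (Fin 3) K) * hCζ + (X 1 ^ 3 + X 2 ^ 3 : MvPolynomial (Fin 3) K) * hC3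

/-- **"`B₁` is obviously isomorphic to the Fermat cubic"**: with `ζ³ = ε` (a primitive ninth root of
unity when `3 ≠ 0`), `B₅ ∘ diag(1, ζ, ζ²) = X³ + Y³ + Z³`. [cite: ArtebaniDolgachev2009, §5, Remark
5.3] -/
theorem halphen_B₅_bind₁_diag_zeta {ω : K} (hω : ω ^ 2 + ω + 1 = 0) {ζ : K} (hζ : ζ ^ 3 = ω) :
    bind₁ (Matrix.of ![![(1 : K), 0, 0], ![0, ζ, 0], ![0, 0, ζ ^ 2]] :
        Matrix (Fin 3) (Fin 3) K).toMvPolynomial 𝐁₅[ω] =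
      (X 0 ^ 3 + X 1 ^ 3 + X 2 ^ 3 : MvPolynomial (Fin 3) K) := by
  have hC3 := C_omega_pow_three hω
  have hCζ := C_zeta_pow_three hζ
  simp only [map_add, map_mul, map_pow, bind₁_X_right, bind₁_C_right, toMvPolynomial_fin_three_h,
    Matrix.of_apply, Matrix.cons_val_zero, Matrix.cons_val_one, Matrix.cons_val_two,
    Matrix.head_cons, Matrix.tail_cons, map_one, map_zero]
  linear_combination (X 1 ^ 3 * C ω ^ 2 + X 2 ^ 3 * C ω ^ 2 + X 2 ^ 3 * C ω * C ζ ^ 3 : MvPolynomial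
    (Fin 3) K) * hCζ + (X 1 ^ 3 + X 2 ^ 3 : MvPolynomial (Fin 3) K) * hC3

/-! ## §5 "they are all projectively equivalent to `B₁`" — explicit matrices -/

/-- **`B₂` is projectively equivalent to `B₁`**: `B₂ ∘ (g₃) = 3·B₁` (the matrix is the product `g₃`
written out, `ε³ = 1`). [cite: ArtebaniDolgachev2009, §5, Remark 5.3 ("they are all projectively
equivalent to `B₁`")] -/
theorem halphen_B₂_bind₁_equiv {ω : K} (hω : ω ^ 2 + ω + 1 = 0) :
    bind₁ (Matrix.of ![![(1 : K), 1, 1], ![1, ω, ω ^ 2], ![1, ω ^ 2, ω]] :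
        Matrix (Fin 3) (Fin 3) K).toMvPolynomial (𝐁₂ : MvPolynomial (Fin 3) K) =
      (3 : K) • 𝐁₁[ω] := by
  have hCrel := C_omega_rel hω
  simp only [map_add, map_mul, map_pow, bind₁_X_right, toMvPolynomial_fin_three_h, Matrix.of_apply,
    Matrix.cons_val_zero, Matrix.cons_val_one, Matrix.cons_val_two, Matrix.head_cons,
    Matrix.tail_cons, map_one, smul_eq_C_mul, map_ofNat]
  linear_combination (3 * X 0 ^ 2 * X 1 + 3 * X 0 ^ 2 * X 2 + X 0 * X 1 ^ 2 * C ω ^ 2 + X 0 * X 1 ^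
    2 * C ω + X 0 * X 1 ^ 2 + 2 * X 0 * X 1 * X 2 * C ω ^ 2 + 2 * X 0 * X 1 * X 2 * C ω + 2 * X 0 *
    X 1 * X 2 + X 0 * X 2 ^ 2 * C ω ^ 2 + X 0 * X 2 ^ 2 * C ω + X 0 * X 2 ^ 2 + 2 * X 1 ^ 3 * C ω ^
    2 - 2 * X 1 ^ 3 * C ω + 2 * X 1 ^ 2 * X 2 * C ω ^ 3 - (X 1 ^ 2 * X 2 * C ω ^ 2) + 2 * X 1 ^ 2 *
    X 2 * C ω + X 1 * X 2 ^ 2 * C ω ^ 4 - (X 1 * X 2 ^ 2 * C ω ^ 3) + 2 * X 1 * X 2 ^ 2 * C ω ^ 2 +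
    X 1 * X 2 ^ 2 * C ω + X 2 ^ 3 * C ω ^ 3 - (X 2 ^ 3 * C ω ^ 2) : MvPolynomial (Fin 3) K) * hCrel

/-- **`B₃` is projectively equivalent to `B₁`**: `B₃ ∘ (g₄²g₃) = 3ω²·B₁` (the matrix is the
product `g₄²g₃` written out, `ε³ = 1`). [cite: ArtebaniDolgachev2009, §5, Remark 5.3 ("they are all
projectively equivalent to `B₁`")] -/
theorem halphen_B₃_bind₁_equiv {ω : K} (hω : ω ^ 2 + ω + 1 = 0) :
    bind₁ (Matrix.of ![![(1 : K), 1, 1], ![ω ^ 2, 1, ω], ![ω ^ 2, ω, 1]] :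
        Matrix (Fin 3) (Fin 3) K).toMvPolynomial 𝐁₃[ω] =
      (3 * ω ^ 2) • 𝐁₁[ω] := by
  have hCrel := C_omega_rel hω
  simp only [map_add, map_mul, map_pow, bind₁_X_right, bind₁_C_right, toMvPolynomial_fin_three_h,
    Matrix.of_apply, Matrix.cons_val_zero, Matrix.cons_val_one, Matrix.cons_val_two,
    Matrix.head_cons, Matrix.tail_cons, map_one, smul_eq_C_mul, map_ofNat]
  linear_combination (X 0 ^ 3 * C ω ^ 6 - (X 0 ^ 3 * C ω ^ 5) + 2 * X 0 ^ 3 * C ω ^ 3 - 2 * X 0 ^ 3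
    * C ω ^ 2 + X 0 ^ 2 * X 1 * C ω ^ 5 + X 0 ^ 2 * X 1 * C ω ^ 4 - (X 0 ^ 2 * X 1 * C ω ^ 3) + 2 *
    X 0 ^ 2 * X 1 * C ω ^ 2 - (X 0 ^ 2 * X 1 * C ω) + X 0 ^ 2 * X 1 + 2 * X 0 ^ 2 * X 2 * C ω ^ 5 -
    (X 0 ^ 2 * X 2 * C ω ^ 4) + X 0 ^ 2 * X 2 * C ω ^ 2 + X 0 ^ 2 * X 2 * C ω + 2 * X 0 * X 1 ^ 2 *
    C ω ^ 3 + X 0 * X 1 ^ 2 * C ω ^ 2 - 2 * X 0 * X 1 ^ 2 * C ω + 2 * X 0 * X 1 ^ 2 + 2 * X 0 * X 1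
    * X 2 * C ω ^ 4 + 2 * X 0 * X 1 * X 2 * C ω ^ 2 + 2 * X 0 * X 1 * X 2 + X 0 * X 2 ^ 2 * C ω ^ 4
    + X 0 * X 2 ^ 2 * C ω ^ 3 - 2 * X 0 * X 2 ^ 2 * C ω ^ 2 + 3 * X 0 * X 2 ^ 2 * C ω - (X 1 ^ 3 * C
    ω) + X 1 ^ 3 + 2 * X 1 ^ 2 * X 2 * C ω ^ 2 - (X 1 ^ 2 * X 2 * C ω) + 2 * X 1 ^ 2 * X 2 + X 1 * X
    2 ^ 2 * C ω ^ 3 - (X 1 * X 2 ^ 2 * C ω ^ 2) + 2 * X 1 * X 2 ^ 2 * C ω + X 1 * X 2 ^ 2 - 2 * X 2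
    ^ 3 * C ω ^ 2 + 2 * X 2 ^ 3 * C ω : MvPolynomial (Fin 3) K) * hCrel

/-- **`B₄` is projectively equivalent to `B₁`**: `B₄ ∘ (g₄g₃) = 3ω·B₁` (the matrix is the product
`g₄g₃` written out, `ε³ = 1`). [cite: ArtebaniDolgachev2009, §5, Remark 5.3 ("they are all
projectively equivalent to `B₁`")] -/
theorem halphen_B₄_bind₁_equiv {ω : K} (hω : ω ^ 2 + ω + 1 = 0) :
    bind₁ (Matrix.of ![![(1 : K), 1, 1], ![ω, ω ^ 2, 1], ![ω, 1, ω ^ 2]] :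
        Matrix (Fin 3) (Fin 3) K).toMvPolynomial 𝐁₄[ω] =
      (3 * ω) • 𝐁₁[ω] := by
  have hCrel := C_omega_rel hω
  simp only [map_add, map_mul, map_pow, bind₁_X_right, bind₁_C_right, toMvPolynomial_fin_three_h,
    Matrix.of_apply, Matrix.cons_val_zero, Matrix.cons_val_one, Matrix.cons_val_two,
    Matrix.head_cons, Matrix.tail_cons, map_one, smul_eq_C_mul, map_ofNat]
  linear_combination (2 * X 0 ^ 3 * C ω ^ 2 - 2 * X 0 ^ 3 * C ω + 2 * X 0 ^ 2 * X 1 * C ω ^ 3 - (X 0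
    ^ 2 * X 1 * C ω ^ 2) + 2 * X 0 ^ 2 * X 1 * C ω + 3 * X 0 ^ 2 * X 2 * C ω ^ 3 - 2 * X 0 ^ 2 * X 2
    * C ω ^ 2 + X 0 ^ 2 * X 2 * C ω + X 0 ^ 2 * X 2 + X 0 * X 1 ^ 2 * C ω ^ 4 - (X 0 * X 1 ^ 2 * C ω
    ^ 3) + 2 * X 0 * X 1 ^ 2 * C ω ^ 2 + X 0 * X 1 ^ 2 * C ω + 2 * X 0 * X 1 * X 2 * C ω ^ 4 + 2 * X
    0 * X 1 * X 2 * C ω ^ 2 + 2 * X 0 * X 1 * X 2 + X 0 * X 2 ^ 2 * C ω ^ 4 + X 0 * X 2 ^ 2 * C ω ^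
    3 - (X 0 * X 2 ^ 2 * C ω) + 2 * X 0 * X 2 ^ 2 + X 1 ^ 3 * C ω ^ 3 - (X 1 ^ 3 * C ω ^ 2) + X 1 ^
    2 * X 2 * C ω ^ 5 - (X 1 ^ 2 * X 2 * C ω ^ 4) + 3 * X 1 ^ 2 * X 2 * C ω ^ 2 - (X 1 ^ 2 * X 2 * C
    ω) + X 1 ^ 2 * X 2 + X 1 * X 2 ^ 2 * C ω ^ 4 + X 1 * X 2 ^ 2 * C ω ^ 3 - (X 1 * X 2 ^ 2 * C ω) +
    2 * X 1 * X 2 ^ 2 + X 2 ^ 3 * C ω ^ 4 - (X 2 ^ 3 * C ω ^ 3) - (X 2 ^ 3 * C ω) + X 2 ^ 3 :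
    MvPolynomial (Fin 3) K) * hCrel

/-- **`B₅` is projectively equivalent to `B₁`**: `B₅ ∘ (g₀) = B₁` (the matrix is the product `g₀`
written out, `ε³ = 1`). [cite: ArtebaniDolgachev2009, §5, Remark 5.3 ("they are all projectively
equivalent to `B₁`")] -/
theorem halphen_B₅_bind₁_equiv (ω : K) :
    bind₁ (Matrix.of ![![(1 : K), 0, 0], ![0, 0, 1], ![0, 1, 0]] :
        Matrix (Fin 3) (Fin 3) K).toMvPolynomial 𝐁₅[ω] =
      𝐁₁[ω] := by
  simp only [map_add, map_mul, map_pow, bind₁_X_right, bind₁_C_right, toMvPolynomial_fin_three_h,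
    Matrix.of_apply, Matrix.cons_val_zero, Matrix.cons_val_one, Matrix.cons_val_two,
    Matrix.head_cons, Matrix.tail_cons, map_one, map_zero]
  ring

/-- **`B₆` is projectively equivalent to `B₁`**: `B₆ ∘ (g₀g₃) = 3·B₁` (the matrix is the product
`g₀g₃` written out, `ε³ = 1`). [cite: ArtebaniDolgachev2009, §5, Remark 5.3 ("they are all
projectively equivalent to `B₁`")] -/
theorem halphen_B₆_bind₁_equiv {ω : K} (hω : ω ^ 2 + ω + 1 = 0) :
    bind₁ (Matrix.of ![![(1 : K), 1, 1], ![1, ω ^ 2, ω], ![1, ω, ω ^ 2]] :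
        Matrix (Fin 3) (Fin 3) K).toMvPolynomial (𝐁₆ : MvPolynomial (Fin 3) K) =
      (3 : K) • 𝐁₁[ω] := by
  have hCrel := C_omega_rel hω
  simp only [map_add, map_mul, map_pow, bind₁_X_right, toMvPolynomial_fin_three_h, Matrix.of_apply,
    Matrix.cons_val_zero, Matrix.cons_val_one, Matrix.cons_val_two, Matrix.head_cons,
    Matrix.tail_cons, map_one, smul_eq_C_mul, map_ofNat]
  linear_combination (3 * X 0 ^ 2 * X 1 + 3 * X 0 ^ 2 * X 2 + X 0 * X 1 ^ 2 * C ω ^ 2 + X 0 * X 1 ^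
    2 * C ω + X 0 * X 1 ^ 2 + 2 * X 0 * X 1 * X 2 * C ω ^ 2 + 2 * X 0 * X 1 * X 2 * C ω + 2 * X 0 *
    X 1 * X 2 + X 0 * X 2 ^ 2 * C ω ^ 2 + X 0 * X 2 ^ 2 * C ω + X 0 * X 2 ^ 2 + 2 * X 1 ^ 3 * C ω ^
    2 - 2 * X 1 ^ 3 * C ω + 2 * X 1 ^ 2 * X 2 * C ω ^ 3 - (X 1 ^ 2 * X 2 * C ω ^ 2) + 2 * X 1 ^ 2 *
    X 2 * C ω + X 1 * X 2 ^ 2 * C ω ^ 4 - (X 1 * X 2 ^ 2 * C ω ^ 3) + 2 * X 1 * X 2 ^ 2 * C ω ^ 2 +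
    X 1 * X 2 ^ 2 * C ω + X 2 ^ 3 * C ω ^ 3 - (X 2 ^ 3 * C ω ^ 2) : MvPolynomial (Fin 3) K) * hCrel

/-- **`B₇` is projectively equivalent to `B₁`**: `B₇ ∘ (g₀g₄²g₃) = 3ω²·B₁` (the matrix is the
product `g₀g₄²g₃` written out, `ε³ = 1`). [cite: ArtebaniDolgachev2009, §5, Remark 5.3 ("they are
all projectively equivalent to `B₁`")] -/
theorem halphen_B₇_bind₁_equiv {ω : K} (hω : ω ^ 2 + ω + 1 = 0) :
    bind₁ (Matrix.of ![![(1 : K), 1, 1], ![ω ^ 2, ω, 1], ![ω ^ 2, 1, ω]] :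
        Matrix (Fin 3) (Fin 3) K).toMvPolynomial 𝐁₇[ω] =
      (3 * ω ^ 2) • 𝐁₁[ω] := by
  have hCrel := C_omega_rel hω
  simp only [map_add, map_mul, map_pow, bind₁_X_right, bind₁_C_right, toMvPolynomial_fin_three_h,
    Matrix.of_apply, Matrix.cons_val_zero, Matrix.cons_val_one, Matrix.cons_val_two,
    Matrix.head_cons, Matrix.tail_cons, map_one, smul_eq_C_mul, map_ofNat]
  linear_combination (X 0 ^ 3 * C ω ^ 6 - (X 0 ^ 3 * C ω ^ 5) + 2 * X 0 ^ 3 * C ω ^ 3 - 2 * X 0 ^ 3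
    * C ω ^ 2 + X 0 ^ 2 * X 1 * C ω ^ 5 + X 0 ^ 2 * X 1 * C ω ^ 4 - (X 0 ^ 2 * X 1 * C ω ^ 3) + 2 *
    X 0 ^ 2 * X 1 * C ω ^ 2 - (X 0 ^ 2 * X 1 * C ω) + X 0 ^ 2 * X 1 + 2 * X 0 ^ 2 * X 2 * C ω ^ 5 -
    (X 0 ^ 2 * X 2 * C ω ^ 4) + X 0 ^ 2 * X 2 * C ω ^ 2 + X 0 ^ 2 * X 2 * C ω + 2 * X 0 * X 1 ^ 2 *
    C ω ^ 3 + X 0 * X 1 ^ 2 * C ω ^ 2 - 2 * X 0 * X 1 ^ 2 * C ω + 2 * X 0 * X 1 ^ 2 + 2 * X 0 * X 1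
    * X 2 * C ω ^ 4 + 2 * X 0 * X 1 * X 2 * C ω ^ 2 + 2 * X 0 * X 1 * X 2 + X 0 * X 2 ^ 2 * C ω ^ 4
    + X 0 * X 2 ^ 2 * C ω ^ 3 - 2 * X 0 * X 2 ^ 2 * C ω ^ 2 + 3 * X 0 * X 2 ^ 2 * C ω - (X 1 ^ 3 * C
    ω) + X 1 ^ 3 + 2 * X 1 ^ 2 * X 2 * C ω ^ 2 - (X 1 ^ 2 * X 2 * C ω) + 2 * X 1 ^ 2 * X 2 + X 1 * X
    2 ^ 2 * C ω ^ 3 - (X 1 * X 2 ^ 2 * C ω ^ 2) + 2 * X 1 * X 2 ^ 2 * C ω + X 1 * X 2 ^ 2 - 2 * X 2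
    ^ 3 * C ω ^ 2 + 2 * X 2 ^ 3 * C ω : MvPolynomial (Fin 3) K) * hCrel

/-- **`B₈` is projectively equivalent to `B₁`**: `B₈ ∘ (g₀g₄g₃) = 3ω·B₁` (the matrix is the
product `g₀g₄g₃` written out, `ε³ = 1`). [cite: ArtebaniDolgachev2009, §5, Remark 5.3 ("they are all
projectively equivalent to `B₁`")] -/
theorem halphen_B₈_bind₁_equiv {ω : K} (hω : ω ^ 2 + ω + 1 = 0) :
    bind₁ (Matrix.of ![![(1 : K), 1, 1], ![ω, 1, ω ^ 2], ![ω, ω ^ 2, 1]] :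
        Matrix (Fin 3) (Fin 3) K).toMvPolynomial 𝐁₈[ω] =
      (3 * ω) • 𝐁₁[ω] := by
  have hCrel := C_omega_rel hω
  simp only [map_add, map_mul, map_pow, bind₁_X_right, bind₁_C_right, toMvPolynomial_fin_three_h,
    Matrix.of_apply, Matrix.cons_val_zero, Matrix.cons_val_one, Matrix.cons_val_two,
    Matrix.head_cons, Matrix.tail_cons, map_one, smul_eq_C_mul, map_ofNat]
  linear_combination (2 * X 0 ^ 3 * C ω ^ 2 - 2 * X 0 ^ 3 * C ω + 2 * X 0 ^ 2 * X 1 * C ω ^ 3 - (X 0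
    ^ 2 * X 1 * C ω ^ 2) + 2 * X 0 ^ 2 * X 1 * C ω + 3 * X 0 ^ 2 * X 2 * C ω ^ 3 - 2 * X 0 ^ 2 * X 2
    * C ω ^ 2 + X 0 ^ 2 * X 2 * C ω + X 0 ^ 2 * X 2 + X 0 * X 1 ^ 2 * C ω ^ 4 - (X 0 * X 1 ^ 2 * C ω
    ^ 3) + 2 * X 0 * X 1 ^ 2 * C ω ^ 2 + X 0 * X 1 ^ 2 * C ω + 2 * X 0 * X 1 * X 2 * C ω ^ 4 + 2 * X
    0 * X 1 * X 2 * C ω ^ 2 + 2 * X 0 * X 1 * X 2 + X 0 * X 2 ^ 2 * C ω ^ 4 + X 0 * X 2 ^ 2 * C ω ^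
    3 - (X 0 * X 2 ^ 2 * C ω) + 2 * X 0 * X 2 ^ 2 + X 1 ^ 3 * C ω ^ 3 - (X 1 ^ 3 * C ω ^ 2) + X 1 ^
    2 * X 2 * C ω ^ 5 - (X 1 ^ 2 * X 2 * C ω ^ 4) + 3 * X 1 ^ 2 * X 2 * C ω ^ 2 - (X 1 ^ 2 * X 2 * C
    ω) + X 1 ^ 2 * X 2 + X 1 * X 2 ^ 2 * C ω ^ 4 + X 1 * X 2 ^ 2 * C ω ^ 3 - (X 1 * X 2 ^ 2 * C ω) +
    2 * X 1 * X 2 ^ 2 + X 2 ^ 3 * C ω ^ 4 - (X 2 ^ 3 * C ω ^ 3) - (X 2 ^ 3 * C ω) + X 2 ^ 3 :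
    MvPolynomial (Fin 3) K) * hCrel

/-- `det(g₄²g₃) = 3ω²(ω − 1)` (`ω² + ω + 1 = 0`). [cite: ArtebaniDolgachev2009, §4 (`g₃, g₄ ∈ PGL(3,
ℂ)`)] -/
theorem halphen_det_M₃ {ω : K} (hω : ω ^ 2 + ω + 1 = 0) :
    (Matrix.of ![![(1 : K), 1, 1], ![ω ^ 2, 1, ω], ![ω ^ 2, ω, 1]] :
        Matrix (Fin 3) (Fin 3) K).det = 3 * ω ^ 2 * (ω - 1) := by
  rw [Matrix.det_fin_three]
  simp only [Matrix.of_apply, Matrix.cons_val_zero, Matrix.cons_val_one, Matrix.cons_val_two,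
    Matrix.head_cons, Matrix.tail_cons]
  linear_combination (-(ω) + 1) * hω

/-- `det(g₄g₃) = 3(ω − 1)` (`ω² + ω + 1 = 0`). [cite: ArtebaniDolgachev2009, §4] -/
theorem halphen_det_M₄ {ω : K} (hω : ω ^ 2 + ω + 1 = 0) :
    (Matrix.of ![![(1 : K), 1, 1], ![ω, ω ^ 2, 1], ![ω, 1, ω ^ 2]] :
        Matrix (Fin 3) (Fin 3) K).det = 3 * (ω - 1) := by
  rw [Matrix.det_fin_three]
  simp only [Matrix.of_apply, Matrix.cons_val_zero, Matrix.cons_val_one, Matrix.cons_val_two,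
    Matrix.head_cons, Matrix.tail_cons]
  linear_combination (ω ^ 2 - 3 * ω + 2) * hω

/-- `det(g₀g₃) = −3ω(ω − 1)` (`ω² + ω + 1 = 0`). [cite: ArtebaniDolgachev2009, §4] -/
theorem halphen_det_M₆ {ω : K} (hω : ω ^ 2 + ω + 1 = 0) :
    (Matrix.of ![![(1 : K), 1, 1], ![1, ω ^ 2, ω], ![1, ω, ω ^ 2]] :
        Matrix (Fin 3) (Fin 3) K).det = -(3 * ω * (ω - 1)) := by
  rw [Matrix.det_fin_three]
  simp only [Matrix.of_apply, Matrix.cons_val_zero, Matrix.cons_val_one, Matrix.cons_val_two,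
    Matrix.head_cons, Matrix.tail_cons]
  linear_combination (ω ^ 2 - (ω)) * hω

/-- `det(g₀g₄²g₃) = −3ω²(ω − 1)` (`ω² + ω + 1 = 0`). [cite: ArtebaniDolgachev2009, §4] -/
theorem halphen_det_M₇ {ω : K} (hω : ω ^ 2 + ω + 1 = 0) :
    (Matrix.of ![![(1 : K), 1, 1], ![ω ^ 2, ω, 1], ![ω ^ 2, 1, ω]] :
        Matrix (Fin 3) (Fin 3) K).det = -(3 * ω ^ 2 * (ω - 1)) := by
  rw [Matrix.det_fin_three]
  simp only [Matrix.of_apply, Matrix.cons_val_zero, Matrix.cons_val_one, Matrix.cons_val_two,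
    Matrix.head_cons, Matrix.tail_cons]
  linear_combination (ω - 1) * hω

/-- `det(g₀g₄g₃) = −3(ω − 1)` (`ω² + ω + 1 = 0`). [cite: ArtebaniDolgachev2009, §4] -/
theorem halphen_det_M₈ {ω : K} (hω : ω ^ 2 + ω + 1 = 0) :
    (Matrix.of ![![(1 : K), 1, 1], ![ω, 1, ω ^ 2], ![ω, ω ^ 2, 1]] :
        Matrix (Fin 3) (Fin 3) K).det = -(3 * (ω - 1)) := by
  rw [Matrix.det_fin_three]
  simp only [Matrix.of_apply, Matrix.cons_val_zero, Matrix.cons_val_one, Matrix.cons_val_two,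
    Matrix.head_cons, Matrix.tail_cons]
  linear_combination (-(ω ^ 2) + 3 * ω - 2) * hω

/-- `det diag(1, ζ², ζ) = ζ³`. [folklore] -/
private theorem det_diag_zeta (ζ : K) :
    (Matrix.of ![![(1 : K), 0, 0], ![0, ζ ^ 2, 0], ![0, 0, ζ]] : Matrix (Fin 3) (Fin 3) K).det =
      ζ ^ 3 := by
  rw [Matrix.det_fin_three]
  simp only [Matrix.of_apply, Matrix.cons_val_zero, Matrix.cons_val_one, Matrix.cons_val_two,
    Matrix.head_cons, Matrix.tail_cons]
  ring

/-- **"the cubics `Bᵢ` are equianharmonic cubics. In fact, they are all projectively equivalent to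
`B₁`, which is obviously isomorphic to the Fermat cubic"**: over a field with `3 ≠ 0` containing
`ω` (`ω² + ω + 1 = 0`) and a cube root `ζ` of `ω`, each of the eight Halphen cubics is carried by an
invertible linear substitution onto a non-zero multiple of the Fermat cubic `x³ + y³ + z³` (the
substitution is `Mᵢ · diag(1, ζ², ζ)` with `Mᵢ` of §5, the multiple is `cᵢ`).
[cite: ArtebaniDolgachev2009, §5, Remark 5.3] -/
theorem halphen_exists_bind₁_eq_smul_fermat (h3 : (3 : K) ≠ 0) {ω : K} (hω : ω ^ 2 + ω + 1 = 0)
    {ζ : K} (hζ : ζ ^ 3 = ω) :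
    ∀ F ∈ ([𝐁₁[ω], 𝐁₂, 𝐁₃[ω], 𝐁₄[ω], 𝐁₅[ω], 𝐁₆, 𝐁₇[ω], 𝐁₈[ω]] :
        List (MvPolynomial (Fin 3) K)),
      ∃ (M : Matrix (Fin 3) (Fin 3) K) (c : K), M.det ≠ 0 ∧ c ≠ 0 ∧
        bind₁ M.toMvPolynomial F = c • (X 0 ^ 3 + X 1 ^ 3 + X 2 ^ 3 : MvPolynomial (Fin 3) K) := by
  have hω0 : ω ≠ 0 := by
    rintro rfl
    norm_num at hω
  have hω1 : ω - 1 ≠ 0 := by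
    intro h
    rw [sub_eq_zero.1 h] at hω
    norm_num at hω
    exact h3 hω
  have hD : (Matrix.of ![![(1 : K), 0, 0], ![0, ζ ^ 2, 0], ![0, 0, ζ]] :
      Matrix (Fin 3) (Fin 3) K).det ≠ 0 := by
    rw [det_diag_zeta, hζ]
    exact hω0
  have hF := halphen_B₁_bind₁_diag_zeta hω hζ
  -- from `B ∘ M = c·B₁` to `B ∘ (M·D) = c·(x³ + y³ + z³)`
  have key : ∀ (F : MvPolynomial (Fin 3) K) (M : Matrix (Fin 3) (Fin 3) K) (c : K),
      M.det ≠ 0 → c ≠ 0 → bind₁ M.toMvPolynomial F = c • 𝐁₁[ω] →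
      ∃ (M' : Matrix (Fin 3) (Fin 3) K) (c' : K), M'.det ≠ 0 ∧ c' ≠ 0 ∧
        bind₁ M'.toMvPolynomial F =
          c' • (X 0 ^ 3 + X 1 ^ 3 + X 2 ^ 3 : MvPolynomial (Fin 3) K) := by
    intro F M c hM hc h
    refine ⟨M * Matrix.of ![![(1 : K), 0, 0], ![0, ζ ^ 2, 0], ![0, 0, ζ]], c, ?_, hc, ?_⟩
    · rw [Matrix.det_mul]
      exact mul_ne_zero hM hD
    · rw [bind₁_toMvPolynomial_mul, h, map_smul, hF]
  have h3ω : 3 * ω ≠ 0 := mul_ne_zero h3 hω0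
  have h3ω2 : 3 * ω ^ 2 ≠ 0 := mul_ne_zero h3 (pow_ne_zero 2 hω0)
  intro F hF'
  simp only [List.mem_cons, List.not_mem_nil, or_false] at hF'
  rcases hF' with rfl | rfl | rfl | rfl | rfl | rfl | rfl | rfl
  · exact ⟨_, 1, hD, one_ne_zero, by rw [hF, one_smul]⟩
  · exact key _ _ _ (det_g₃_ne_zero h3 hω) h3 (halphen_B₂_bind₁_equiv hω)
  · refine key _ _ _ ?_ h3ω2 (halphen_B₃_bind₁_equiv hω)
    rw [halphen_det_M₃ hω]
    exact mul_ne_zero h3ω2 hω1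
  · refine key _ _ _ ?_ h3ω (halphen_B₄_bind₁_equiv hω)
    rw [halphen_det_M₄ hω]
    exact mul_ne_zero h3 hω1
  · refine key _ (Matrix.of ![![(1 : K), 0, 0], ![0, 0, 1], ![0, 1, 0]]) 1 ?_ one_ne_zero ?_
    · rw [Matrix.det_fin_three]
      simp only [Matrix.of_apply, Matrix.cons_val_zero, Matrix.cons_val_one, Matrix.cons_val_two,
        Matrix.head_cons, Matrix.tail_cons]
      norm_num
    · rw [one_smul]
      exact halphen_B₅_bind₁_equiv ω
  · refine key _ _ _ ?_ h3 (halphen_B₆_bind₁_equiv hω)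
    rw [halphen_det_M₆ hω]
    exact neg_ne_zero.2 (mul_ne_zero h3ω hω1)
  · refine key _ _ _ ?_ h3ω2 (halphen_B₇_bind₁_equiv hω)
    rw [halphen_det_M₇ hω]
    exact neg_ne_zero.2 (mul_ne_zero h3ω2 hω1)
  · refine key _ _ _ ?_ h3ω (halphen_B₈_bind₁_equiv hω)
    rw [halphen_det_M₈ hω]
    exact neg_ne_zero.2 (mul_ne_zero h3 hω1)

end HalphenCubics

end Literature.AlgebraicGeometry.PlaneCurves
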